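import Literature.NumberTheory.DiophantineGeometry.DetOrbitSymKroneckerBound
import Literature.Computability.AlgebraicComplexity.PerStabilizerMarcusMayProofs
import Literature.Computability.AlgebraicComplexity.IK2020OrbitClosureInvariantBound
import HarnessLib

/-!
# BLMW 2011 §5.5, the permanent side of Prop. 5.5.2 (5.5.3) in bound-space form: a PROVED
# ceiling for the multiplicities in `ℂ[\overline{GL(W)·per_m}]`

P. Bürgisser, J. M. Landsberg, L. Manivel, J. Weyman, SIAM J. Comput. **40** (2011) §5.5
[BurgisserEtAl2011]: for `W = E ⊗ F = Mat_{m×m}` and `m ≥ 3` the stabilizer of `per_m` is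
`GL(W)(per_m) = ((T_E ⋊ 𝔚_E) × (T_F ⋊ 𝔚_F))/μ_m ⋊ ℤ₂` ((5.5.1), Marcus–May), and
"`ℂ[\overline{GL(W)·per_m}]_δ ⊆ ⊕_π (S_πW^*)^{⊕ mult_π}`" ((5.5.3)) with
`mult_π = dim (S_πW)^{GL(W)(per_m)}` ((5.5.2) via (4.1.2)). The printed closed formula for
`mult_π` (Def. 5.5.1) omits a summand (ERRATUM recorded in `BLMW11StabilityInheritance.lean`,
val-lit t03 g3); this file does not use any closed formula. It PROVES the inequality behind
(5.5.3) in the tree's word model, exactly as the determinant twin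
`orbitMultiplicity_det_le_symKroneckerCoeffRect` (`DetOrbitSymKroneckerBound.lean`) does for
Prop. 5.2.1:

* `orbitMultiplicity_per_le_perOrbitCeiling` — over a field of characteristic zero, for
  `λ ⊢ m·d` with at most `m²` parts, the multiplicity of `λ*` in `k[Δ_m(per_m)]`
  (`orbitMultiplicity k (paddedPerFormLex k m m) m λ*`) is at most
  `perOrbitCeiling k m d λ := dim boundSpace λ* (perStabInvariants k m (m d))`, the dimension of
  the space of `𝔖_{md}`-invariant coefficient matrices with columns in the weight space
  `Y_{λ*} ≅ [λ]` and rows in the vectors of `W^{⊗ md}` fixed by the stabilizing family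
  `IsPerStab` (pairs of diagonal matrices `diag(…,2,…) ⊗ diag(…,½,…)`, permutation matrices on
  either factor, and the transposition) — i.e. `dim ([λ] ⊗ X)^{𝔖_{md}}` with
  `X ⊇ (W^{⊗ md})^{GL(W)(per_m)}`; this is BLMW's `mult_{λ} ℂ[\overline{GL·per_m}]_d ≤
  dim (S_λW)^{H}` for the subgroup `H ⊆ GL(W)(per_m)` generated by the family.

* `mem_perStabInvariants_iff_symSlice`, `perStabInvariantsEquivSymSlice` — the structure of `X`:
  splitting bi-words identifies `X` (as an `𝔖_D`-representation) with the symmetric slice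
  functions `Sym²(X₀)` over `X₀ = perSliceSpace` = functions on words supported on the words of
  constant content and invariant under relabelling the letters (`((E^{⊗D})_0)^{𝔚_E}`, whose
  `[μ]`-multiplicity is BLMW's `p_μ = dim (S_μE)_0^{𝔚_E}`) — the coordinate form of BLMW's
  computation of `(S_π(E ⊗ F))^{N_E × N_F, τ}`, with the full `τ`-fixed space
  `Sym²X_μ ⊗ (K^π_{μμ})^+ ⊕ Λ²X_μ ⊗ (K^π_{μμ})^-`.
* `two_mul_factorial_mul_perOrbitCeiling` — the character formula
  `2·(md)!·perOrbitCeiling λ = ∑_τ χ^λ(τ)(χ₀(τ)² + χ₀(τ²))`, `χ₀` the character of `𝔖_{md}` on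
  `X₀` (permanent twin of `two_mul_factorial_mul_symKroneckerCoeffRect`, where `χ₀ = χ^□`).

* `perStabInvariants_eq_invariants_stabilizer`, `perOrbitCeiling_eq_weylInvariantDim` (§5, over
  `ℂ`, `m ≥ 3`) — by Marcus–May (tree `marcusMay1962_perPreserver_sandwich_holds`: the stabilizer
  of `per_m` consists of monomial sandwiches, possibly transposed) the family has the SAME fixed
  vectors as the whole stabilizer `H_per`, so the ceiling IS `dim {λ}^{H_per}`
  (Ikenmeyer–Kandasamy's `IK2020.weylInvariantDim`, via their
  `finrank_boundSpace_invariants_eq_weylInvariantDim`) — the multiplicity of `S_λW^*` in the ORBIT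
  ring `ℂ[GL(W)·per_m]` by (4.1.2) — and `two_mul_factorial_mul_weylInvariantDim_per` is a PROVED
  character formula for the quantity of BLMW's (5.5.2) (in the `Fin (m²)`-indexed Weyl-module
  rendering); over any field of characteristic zero the inequality
  `dim {λ}^{H_per} ≤ perOrbitCeiling` (`weylInvariantDim_per_le_perOrbitCeiling`).

Turning `χ₀` into `∑_μ p_μ χ^μ` with `p_μ` the plethysm coefficient `mult(S_μE, S^m(S^δE))`, and
hence `perOrbitCeiling` into BLMW's (corrected) closed formula `BLMW2011.multPer`
(`½ ∑_{μ≠ν} k_{λμν} p_μ p_ν + ∑_μ [sk C(p_μ+1,2) + (k - sk) C(p_μ,2)]`), needs Cor. 8.4.2 (Gay),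
a named fact of `BLMW11KroneckerApproximation.lean`, and is NOT done here; nor is a closed
counting formula for `χ₀` (number of `τ`-fixed `𝔚_E`-orbits of constant-content words), nor the
transport between the `Fin (m²)`-indexed Weyl module and the `MatIdx m`-indexed
`schurRep (stdRep (MatIdx m) ℂ) π` of the named fact `BLMW2011_prop_5_5_2_invariants`.

Typed literature support for cell `val-lit` (D-0074 GROUP L), row `BLMW11-A`; **`VP ≠ VNP` is not
proved and nothing here is progress on it**. No named facts are introduced (D-0026).

## Proof

`finrank_highestWeightSpace_orbitCoordRep_le` (`SchurWeylPlethysmKroneckerBoundProofs.lean`,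
§1–§3': `mult_χ k[Δ_m[f]] ≤ dim boundSpace χ X` for any family `S ⊆ GL_N` stabilising `f` and any
`X` containing the `S`-fixed vectors of `W^{⊗D}`) applied to `f = per_m` in the lexicographic
matrix variables (`paddedPerFormLex k m m = rename toLex per_m`, `paddedPerFormLex_self`), the
family `IsPerStab` and `X = perStabInvariants` (the common fixed space, so that the containment
hypothesis is `id`). The stabiliser lemmas are `(a ⊗ b)·per_m = per(aᵀ X b)`
(`linSubst_kronecker_perPoly`) with Minc's `per(D X L) = (∏d)(∏l) per X`, `per(P_σ X) = per X`
(`MarcusMay.permanent_diagonal_mul`, …) and `per(Xᵀ) = per X`. The structure theorem tests the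
family on functions of pairs of words: a torus pair acts by `2^{content_i(u) - content_j(v)}`
(`splitFun_wordRep_torusPair`), a permutation matrix by relabelling one word, the transposition by
swapping the two words; the character formula is `card_mul_finrank_boundSpace` +
`two_mul_character_symSlice` (`SymmetricSliceCharacter.lean`). §5: a stabilizer element `γ` is,
by Marcus–May, a monomial matrix on bi-letters (`entry_of_sandwich`: `γ_{q'q} = [q' = θ q] d_{q₁} l_{q₂}`,
`θ (a, b) = (π a, ρ⁻¹ b)` or `(ρ⁻¹ b, π a)`), which acts on functions of bi-words by relabelling rows
and columns (and transposing) times the weight `∏_p d(u_p) l(v_p)`, equal to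
`((∏ d)(∏ l))^{content} = 1` on the support (constant contents; `wordRep_apply_of_monomial`,
`prod_weights_eq_one_of_ne_zero`).

## References

* [BurgisserEtAl2011] BLMW 2011, §5.5 (5.5.1), Def. 5.5.1, Prop. 5.5.2 (5.5.2)–(5.5.3); §4.1
  (4.1.2); §5.2 (the method, Prop. 5.2.1).
* [MarcusMay1962] M. Marcus, F. C. May, *The permanent function*, Canad. J. Math. 14 (1962)
  (the stabilizer; tree `PerStabilizerMarcusMay.lean`).
* [Minc1978] H. Minc, *Permanents*, Ch. 2, Thm. 1.1 (row/column scaling, permutation,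
  transposition invariance).
* [FultonHarrisGTM129] W. Fulton, J. Harris, *Representation Theory*, §6.1 (Schur–Weyl duality
  in coordinates).
* [IkenmeyerKandasamy2019] C. Ikenmeyer, U. Kandasamy, STOC 2020 = arXiv:1911.03990, §9 (9.3)–(9.4)
  (`HWV_{λ^*}(ℂ[G]^H) ≃ {λ}^H`; tree `IK2020OrbitClosureInvariantBound.lean`).
-/

noncomputable section

open MvPolynomial
open scoped BigOperators Matrix Kronecker

namespace Literature.Computability.AlgebraicComplexity

open _root_.Literature.NumberTheory.DiophantineGeometry

/-! ### §1 Elements of the stabilizer of `per_m` -/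

section Stabilizer

variable (k : Type*) [Field k] (m : ℕ)

/-- A ring homomorphism commutes with the permanent: `f (per M) = per (f ∘ M)`. [folklore] -/
private theorem ringHom_map_permanent {ι : Type*} [Fintype ι] [DecidableEq ι] {A B : Type*}
    [CommRing A] [CommRing B] (f : A →+* B) (M : Matrix ι ι A) :
    f M.permanent = (f.mapMatrix M).permanent := by
  simp only [Matrix.permanent, map_sum, map_prod, RingHom.mapMatrix_apply, Matrix.map_apply]

/-- A ring-homomorphism-like map commutes with the permanent (`FunLike` form, for `AlgHom`s such
as `rename`). [folklore] -/
private theorem map_permanent' {ι : Type*} [Fintype ι] [DecidableEq ι] {A B F : Type*}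
    [CommRing A] [CommRing B] [FunLike F A B] [RingHomClass F A B] (f : F) (M : Matrix ι ι A) :
    f M.permanent = (M.map f).permanent := by
  simp only [Matrix.permanent, map_sum, map_prod, Matrix.map_apply]

/-- **`(a ⊗ b) · per_m = per(aᵀ X b)`.** The linear substitution by the Kronecker product
`a ⊗ₖ b` sends the generic matrix `X` to `aᵀ X b` (as for the determinant,
`linSubst_kronecker_detPoly`), hence the generic permanent to `per(aᵀ X b)`. BLMW 2011 §5.5
(the action of `GL(E) × GL(F)` on `S^m(E ⊗ F)`). [cite: BurgisserEtAl2011, §5.5 (5.5.1)] -/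
theorem linSubst_kronecker_perPoly (a b : Matrix (Fin m) (Fin m) k) :
    linSubst (Fin m × Fin m) k (a ⊗ₖ b) (perPoly (Fin m) k) =
      ((aᵀ).map (C : k →+* MvPolynomial (Fin m × Fin m) k) * Matrix.mvPolynomialX (Fin m) (Fin m) k *
        b.map (C : k →+* MvPolynomial (Fin m × Fin m) k)).permanent := by
  unfold perPoly
  rw [show (linSubst (Fin m × Fin m) k (a ⊗ₖ b)) (Matrix.mvPolynomialX (Fin m) (Fin m) k).permanent =
      ((linSubst (Fin m × Fin m) k (a ⊗ₖ b) : MvPolynomial (Fin m × Fin m) k →+*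
        MvPolynomial (Fin m × Fin m) k).mapMatrix (Matrix.mvPolynomialX (Fin m) (Fin m) k)).permanent
      from ringHom_map_permanent _ _]
  congr 1
  refine Matrix.ext fun i j => ?_
  rw [RingHom.mapMatrix_apply, Matrix.map_apply, Matrix.mvPolynomialX_apply, RingHom.coe_coe,
    linSubst_X]
  simp only [Matrix.mul_apply, Matrix.map_apply, Matrix.transpose_apply,
    Matrix.mvPolynomialX_apply, Matrix.kroneckerMap_apply, Finset.sum_mul]
  rw [Fintype.sum_prod_type, Finset.sum_comm]
  refine Finset.sum_congr rfl fun y _ => Finset.sum_congr rfl fun x _ => ?_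
  rw [smul_eq_C_mul, map_mul]
  ring

/-- **Pairs of diagonal matrices scale `per_m`**: `(diag d ⊗ diag l) · per_m = (∏ d)(∏ l) per_m`
(Minc, Ch. 2, Thm. 1.1(a); BLMW 2011 (5.5.1): `T_E × T_F ⊂ GL(W)(per_m)` up to the scalar
condition). [cite: BurgisserEtAl2011, §5.5 (5.5.1)] -/
theorem linSubst_kronecker_diagonal_perPoly (d l : Fin m → k) :
    linSubst (Fin m × Fin m) k (Matrix.diagonal d ⊗ₖ Matrix.diagonal l) (perPoly (Fin m) k) =
      ((∏ i, d i) * ∏ i, l i) • perPoly (Fin m) k := by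
  rw [linSubst_kronecker_perPoly, Matrix.diagonal_transpose, Matrix.diagonal_map (map_zero _),
    Matrix.diagonal_map (map_zero _), MarcusMay.permanent_mul_diagonal,
    MarcusMay.permanent_diagonal_mul, smul_eq_C_mul, map_mul, map_prod, map_prod]
  unfold perPoly
  ring

/-- **Relabelling rows and columns fixes `per_m`**: `rename (ρ × ρ') per_m = per_m` for
permutations `ρ, ρ'` of the row and column indices (`per(P_σ X P_τ) = per X`, Minc, Ch. 2,
Thm. 1.1(b); BLMW 2011 (5.5.1): `𝔚_E × 𝔚_F ⊂ GL(W)(per_m)`). [cite: BurgisserEtAl2011, §5.5 (5.5.1)] -/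
theorem rename_prodCongr_perPoly (ρ ρ' : Equiv.Perm (Fin m)) :
    rename (Equiv.prodCongr ρ ρ') (perPoly (Fin m) k) = perPoly (Fin m) k := by
  unfold perPoly
  simp only [Matrix.permanent, map_sum, map_prod, Matrix.mvPolynomialX_apply, rename_X,
    Equiv.prodCongr_apply, Prod.map_apply]
  -- reindex the inner product along `ρ'` and the outer sum along `π ↦ ρ π ρ'⁻¹`
  have hinner : ∀ π : Equiv.Perm (Fin m),
      (∏ i, (X (ρ (π i), ρ' i) : MvPolynomial (Fin m × Fin m) k)) =
        ∏ i, X ((ρ * π * ρ'⁻¹) i, i) := fun π => by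
    rw [← Equiv.prod_comp ρ' (fun i => (X ((ρ * π * ρ'⁻¹) i, i) : MvPolynomial (Fin m × Fin m) k))]
    refine Finset.prod_congr rfl fun i _ => ?_
    simp [Equiv.Perm.mul_apply]
  simp_rw [hinner]
  exact Fintype.sum_equiv ((Equiv.mulRight ρ'⁻¹).trans (Equiv.mulLeft ρ)) _ _ fun π => by
    simp [mul_assoc]

/-- `P_σ ⊗ 1` is the permutation matrix of `σ × 1` on `Fin m × Fin m`. [folklore] -/
private theorem permMatrix_kronecker_one (σ : Equiv.Perm (Fin m)) :
    σ.permMatrix k ⊗ₖ (1 : Matrix (Fin m) (Fin m) k) =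
      Equiv.Perm.permMatrix k (Equiv.prodCongr σ (Equiv.refl (Fin m))) := by
  ext ⟨i, j⟩ ⟨i', j'⟩
  rw [Matrix.kroneckerMap_apply, permMatrix_apply', permMatrix_apply', Matrix.one_apply]
  by_cases h1 : σ i = i' <;> by_cases h2 : j = j' <;> simp [h1, h2]

/-- `1 ⊗ P_τ` is the permutation matrix of `1 × τ` on `Fin m × Fin m`. [folklore] -/
private theorem one_kronecker_permMatrix (τ : Equiv.Perm (Fin m)) :
    (1 : Matrix (Fin m) (Fin m) k) ⊗ₖ τ.permMatrix k =
      Equiv.Perm.permMatrix k (Equiv.prodCongr (Equiv.refl (Fin m)) τ) := by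
  ext ⟨i, j⟩ ⟨i', j'⟩
  rw [Matrix.kroneckerMap_apply, permMatrix_apply', permMatrix_apply', Matrix.one_apply]
  by_cases h1 : i = i' <;> by_cases h2 : τ j = j' <;> simp [h1, h2]

/-- **`P_σ ⊗ 1` fixes `per_m`** (row relabelling). [cite: BurgisserEtAl2011, §5.5 (5.5.1)] -/
theorem linSubst_permMatrix_kronecker_one_perPoly (σ : Equiv.Perm (Fin m)) :
    linSubst (Fin m × Fin m) k (σ.permMatrix k ⊗ₖ (1 : Matrix (Fin m) (Fin m) k))
      (perPoly (Fin m) k) = perPoly (Fin m) k := by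
  rw [permMatrix_kronecker_one, linSubst_permMatrix]
  have h : (Equiv.prodCongr σ (Equiv.refl (Fin m))).symm = Equiv.prodCongr σ.symm (Equiv.refl _) :=
    rfl
  rw [h]
  exact rename_prodCongr_perPoly k m σ.symm (Equiv.refl _)

/-- **`1 ⊗ P_τ` fixes `per_m`** (column relabelling). [cite: BurgisserEtAl2011, §5.5 (5.5.1)] -/
theorem linSubst_one_kronecker_permMatrix_perPoly (τ : Equiv.Perm (Fin m)) :
    linSubst (Fin m × Fin m) k ((1 : Matrix (Fin m) (Fin m) k) ⊗ₖ τ.permMatrix k)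
      (perPoly (Fin m) k) = perPoly (Fin m) k := by
  rw [one_kronecker_permMatrix, linSubst_permMatrix]
  have h : (Equiv.prodCongr (Equiv.refl (Fin m)) τ).symm = Equiv.prodCongr (Equiv.refl _) τ.symm :=
    rfl
  rw [h]
  exact rename_prodCongr_perPoly k m (Equiv.refl _) τ.symm

/-- **`per(Xᵀ) = per X` for the generic matrix**: renaming `X_{(i,j)} ↦ X_{(j,i)}` fixes `per_m`
(Minc, Ch. 2, Thm. 1.1(c); BLMW 2011 (5.5.1): the transposition `τ ∈ GL(W)(per_m)`).
[cite: BurgisserEtAl2011, §5.5 (5.5.1)] -/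
theorem rename_swap_perPoly_fin :
    rename (Prod.swap : Fin m × Fin m → Fin m × Fin m) (perPoly (Fin m) k) = perPoly (Fin m) k := by
  unfold perPoly
  rw [map_permanent']
  have h : (Matrix.mvPolynomialX (Fin m) (Fin m) k).map
        (rename (Prod.swap : Fin m × Fin m → Fin m × Fin m)) =
      (Matrix.mvPolynomialX (Fin m) (Fin m) k)ᵀ := by
    refine Matrix.ext fun i j => ?_
    rw [Matrix.map_apply, Matrix.mvPolynomialX_apply, rename_X, Matrix.transpose_apply,
      Matrix.mvPolynomialX_apply, Prod.swap_prod_mk]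
  rw [h, Matrix.permanent_transpose]

variable [NeZero m]

/-- At `n = m` the padded permanent is the permanent: `X₀₀^0 · per_m(block) = per_m` (the block
`BlockIdx m m` is all of `Fin m`; the case `n = m` of the tree's `paddedPerPoly`, Mulmuley–Sohoni
2001 §4). [cite: MulmuleySohoni2001, §4] -/
theorem paddedPerPoly_self : paddedPerPoly k m m = perPoly (Fin m) k := by
  classical
  have hB : ∀ i : Fin m, m - m ≤ (i : ℕ) := fun i => by simp
  let e : BlockIdx m m ≃ Fin m := Equiv.subtypeUnivEquiv hB
  have h1 : (X ((0 : Fin m), (0 : Fin m)) : MvPolynomial (Fin m × Fin m) k) ^ (m - m) = 1 := by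
    rw [Nat.sub_self, pow_zero]
  rw [paddedPerPoly, h1, one_mul, perPoly, perPoly, Matrix.permanent, Matrix.permanent, map_sum]
  simp only [map_prod, Matrix.mvPolynomialX_apply, rename_X]
  rw [← Equiv.sum_comp (Equiv.permCongr e)]
  refine Finset.sum_congr rfl fun σ _ => ?_
  rw [← Equiv.prod_comp e]
  refine Finset.prod_congr rfl fun i _ => ?_
  simp [e, Equiv.permCongr_apply, Equiv.subtypeUnivEquiv]

/-- `per_m` in the lexicographic matrix variables: `paddedPerFormLex k m m = rename toLex per_m`
(the case `n = m` of the tree's `paddedPerFormLex`, Mulmuley–Sohoni 2001 §4).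
[cite: MulmuleySohoni2001, §4] -/
theorem paddedPerFormLex_self :
    paddedPerFormLex k m m = rename (toLex : Fin m × Fin m → MatIdx m) (perPoly (Fin m) k) := by
  rw [paddedPerFormLex, paddedPerPoly_self]

/-- Transport of a stabiliser identity from `Fin m × Fin m` to the lexicographic variables: if the
matrix `M` fixes `per_m` under `linSubst`, then `reindex toLex toLex M` fixes `paddedPerFormLex k m m`
(`rename_linSubst`). [folklore] -/
private theorem linSubst_reindex_paddedPerFormLex_self {M : Matrix (Fin m × Fin m) (Fin m × Fin m) k}
    (h : linSubst (Fin m × Fin m) k M (perPoly (Fin m) k) = perPoly (Fin m) k) :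
    linSubst (MatIdx m) k (Matrix.reindex toLex toLex M) (paddedPerFormLex k m m) =
      paddedPerFormLex k m m := by
  rw [paddedPerFormLex_self]
  have h' := rename_linSubst (toLex : (Fin m × Fin m) ≃ MatIdx m) M (perPoly (Fin m) k)
  rw [h] at h'
  exact h'.symm

/-- **`a ⊗ b` (reindexed to `MatIdx m`) fixes `per_m` in the lexicographic variables whenever
`(a ⊗ b) · per_m = per_m`** (`coe_reindexGL_kronFin`). [cite: BurgisserEtAl2011, §5.5 (5.5.1)] -/
theorem linSubstRep_reindexGL_kronFin_paddedPerFormLex {a b : GL (Fin m) k}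
    (h : linSubst (Fin m × Fin m) k ((a : Matrix (Fin m) (Fin m) k) ⊗ₖ (b : Matrix (Fin m) (Fin m) k))
      (perPoly (Fin m) k) = perPoly (Fin m) k) :
    linSubstRep (MatIdx m) k (reindexGL (k := k) (matIdxEquiv m) (kronFin k m a b))
      (paddedPerFormLex k m m) = paddedPerFormLex k m m := by
  rw [linSubstRep_apply, coe_reindexGL_kronFin]
  exact linSubst_reindex_paddedPerFormLex_self k m h

/-- **The transposition `swapGL` (reindexed to `MatIdx m`) fixes `per_m`** in the lexicographic
variables (as `linSubstRep_reindexGL_swapGL_detFormLex` for the determinant).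
[cite: BurgisserEtAl2011, §5.5 (5.5.1)] -/
theorem linSubstRep_reindexGL_swapGL_paddedPerFormLex :
    linSubstRep (MatIdx m) k (reindexGL (k := k) (matIdxEquiv m) (swapGL k m))
      (paddedPerFormLex k m m) = paddedPerFormLex k m m := by
  rw [linSubstRep_apply, coe_reindexGL_swapGL, linSubst_permMatrix, paddedPerFormLex_self,
    rename_rename]
  have hfun : (⇑(swapPermLex m).symm ∘ (toLex : Fin m × Fin m → MatIdx m)) = toLex ∘ Prod.swap := by
    funext ij
    obtain ⟨i, j⟩ := ij
    rw [Function.comp_apply, Function.comp_apply, Equiv.symm_apply_eq, Prod.swap_prod_mk]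
    rfl
  rw [hfun, ← rename_rename, rename_swap_perPoly_fin]

end Stabilizer

/-! ### §2 The stabilizing family and its invariants in `W^{⊗D}` -/

section Family

variable (k : Type*) [Field k] (m : ℕ)

namespace PerStab

/-- An invertible diagonal matrix as an element of `GL_m(k)`. [folklore] -/
def diagGL (d : Fin m → k) (hd : ∀ i, d i ≠ 0) : GL (Fin m) k :=
  Matrix.GeneralLinearGroup.mkOfDetNeZero (Matrix.diagonal d)
    (by rw [Matrix.det_diagonal]; exact Finset.prod_ne_zero_iff.mpr fun i _ => hd i)

/-- The matrix of `diagGL` (unfolding lemma). [folklore] -/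
@[simp]
private theorem coe_diagGL (d : Fin m → k) (hd : ∀ i, d i ≠ 0) :
    ((diagGL k m d hd : GL (Fin m) k) : Matrix (Fin m) (Fin m) k) = Matrix.diagonal d :=
  rfl

/-- A permutation matrix as an element of `GL_m(k)` (`𝔚_E`, the Weyl group of permutation
matrices, BLMW 2011 §5.5). [cite: BurgisserEtAl2011, §5.5] -/
def permGL (σ : Equiv.Perm (Fin m)) : GL (Fin m) k where
  val := σ.permMatrix k
  inv := σ⁻¹.permMatrix k
  val_inv := by rw [← Matrix.permMatrix_mul, inv_mul_cancel, Matrix.permMatrix_one]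
  inv_val := by rw [← Matrix.permMatrix_mul, mul_inv_cancel, Matrix.permMatrix_one]

/-- The matrix of `permGL` (unfolding lemma). [folklore] -/
@[simp]
private theorem coe_permGL (σ : Equiv.Perm (Fin m)) :
    ((permGL k m σ : GL (Fin m) k) : Matrix (Fin m) (Fin m) k) = σ.permMatrix k :=
  rfl

/-- The diagonal `diag(1, …, c, …, 1)` with `c` in position `i`. [folklore] -/
def scaleAt (i : Fin m) (c : k) : Fin m → k := fun j => if j = i then c else 1

/-- `∏_j scaleAt i c j = c`. [folklore] -/
private theorem prod_scaleAt (i : Fin m) (c : k) : ∏ j, scaleAt k m i c j = c := by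
  unfold scaleAt
  rw [Finset.prod_ite_eq' Finset.univ i (fun _ => c), if_pos (Finset.mem_univ i)]

variable [CharZero k]

/-- The entries of `scaleAt i 2` are non-zero (characteristic zero). [folklore] -/
private theorem scaleAt_two_ne_zero (i j : Fin m) : scaleAt k m i 2 j ≠ 0 := by
  unfold scaleAt; split_ifs <;> norm_num

/-- The entries of `scaleAt i 2⁻¹` are non-zero (characteristic zero). [folklore] -/
private theorem scaleAt_inv_two_ne_zero (i j : Fin m) : scaleAt k m i (2⁻¹) j ≠ 0 := by
  unfold scaleAt; split_ifs <;> norm_num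

/-- The torus element `diag(1,…,2,…,1) ⊗ diag(1,…,½,…,1)` (`2` at row index `i`, `½` at column
index `j`) of the stabilizer of `per_m` (`per(D X L) = (∏d)(∏l) per X = per X`). BLMW 2011
(5.5.1) (`T_E × T_F`, up to the scalar condition). [cite: BurgisserEtAl2011, §5.5 (5.5.1)] -/
def torusPair (i j : Fin m) : GL (Fin (m * m)) k :=
  kronFin k m (diagGL k m (scaleAt k m i 2) (scaleAt_two_ne_zero k m i))
    (diagGL k m (scaleAt k m j 2⁻¹) (scaleAt_inv_two_ne_zero k m j))

end PerStab

variable [CharZero k]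

/-- **The stabilizing family used for the permanent**: the torus elements `torusPair i j`, the
permutation matrices `P_σ ⊗ 1` and `1 ⊗ P_σ` (`𝔚_E × 𝔚_F`), and the transposition `swapGL` —
generators (up to scalars) of `GL(W)(per_m) = ((T_E ⋊ 𝔚_E) × (T_F ⋊ 𝔚_F))/μ_m ⋊ ℤ₂`, BLMW 2011
(5.5.1). [cite: BurgisserEtAl2011, §5.5 (5.5.1)] -/
def IsPerStab (h : GL (Fin (m * m)) k) : Prop :=
  (∃ i j : Fin m, h = PerStab.torusPair k m i j) ∨
    (∃ σ : Equiv.Perm (Fin m), h = kronFin k m (PerStab.permGL k m σ) 1) ∨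
    (∃ σ : Equiv.Perm (Fin m), h = kronFin k m 1 (PerStab.permGL k m σ)) ∨ h = swapGL k m

open PerStab in
/-- **Every element of the family fixes `per_m`** (in the lexicographic matrix variables,
reindexed along `matIdxEquiv`). [cite: BurgisserEtAl2011, §5.5 (5.5.1)] -/
theorem linSubstRep_reindexGL_paddedPerFormLex_of_isPerStab [NeZero m] {h : GL (Fin (m * m)) k}
    (hh : IsPerStab k m h) :
    linSubstRep (MatIdx m) k (reindexGL (k := k) (matIdxEquiv m) h) (paddedPerFormLex k m m) =
      paddedPerFormLex k m m := by
  rcases hh with ⟨i, j, rfl⟩ | ⟨σ, rfl⟩ | ⟨σ, rfl⟩ | rfl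
  · refine linSubstRep_reindexGL_kronFin_paddedPerFormLex k m ?_
    rw [coe_diagGL, coe_diagGL, linSubst_kronecker_diagonal_perPoly, prod_scaleAt, prod_scaleAt,
      mul_inv_cancel₀ (two_ne_zero : (2 : k) ≠ 0), one_smul]
  · exact linSubstRep_reindexGL_kronFin_paddedPerFormLex k m
      (by rw [coe_permGL, Units.val_one, linSubst_permMatrix_kronecker_one_perPoly])
  · exact linSubstRep_reindexGL_kronFin_paddedPerFormLex k m
      (by rw [coe_permGL, Units.val_one, linSubst_one_kronecker_permMatrix_perPoly])
  · exact linSubstRep_reindexGL_swapGL_paddedPerFormLex k m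

/-- **The `per`-stabilizer invariants**: the vectors of `W^{⊗D}`, `W = E ⊗ F = k^{m²}`, fixed by
every element of the family `IsPerStab`. They contain the `H`-invariants `(W^{⊗D})^{GL(W)(per_m)}`
of BLMW 2011 §5.5 (proof of Prop. 5.5.2). [cite: BurgisserEtAl2011, Prop. 5.5.2 (proof)] -/
def perStabInvariants (D : ℕ) : Submodule k (Word (m * m) D → k) where
  carrier := {x | ∀ h, IsPerStab k m h → wordRep k (m * m) D h x = x}
  add_mem' {x y} hx hy h hh := by rw [map_add, hx h hh, hy h hh]
  zero_mem' h _ := by rw [map_zero]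
  smul_mem' c {x} hx h hh := by rw [map_smul, hx h hh]

variable {k m} {D : ℕ}

/-- Membership in `perStabInvariants` (unfolding lemma): fixed by every element of the family.
[cite: BurgisserEtAl2011, Prop. 5.5.2 (proof)] -/
theorem mem_perStabInvariants_iff (x : Word (m * m) D → k) :
    x ∈ perStabInvariants k m D ↔ ∀ h, IsPerStab k m h → wordRep k (m * m) D h x = x :=
  Iff.rfl

variable (k m) in
/-- The `per`-stabilizer invariants are stable under the permutations of the positions (the
actions of `𝔖_D` and `GL_{m²}` on `W^{⊗D}` commute, `wordPerm_wordRep`; Fulton–Harris Lemma 6.22).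
[cite: FultonHarrisGTM129, §6.1 Lemma 6.22] -/
theorem wordPerm_mem_perStabInvariants (τ : Equiv.Perm (Fin D)) {x : Word (m * m) D → k}
    (hx : x ∈ perStabInvariants k m D) : wordPerm k τ x ∈ perStabInvariants k m D := by
  intro h hh
  rw [← wordPerm_wordRep, hx h hh]

variable (k m) in
/-- `𝔖_D`-stability of `perStabInvariants` in the form used by `sliceRep` /
`card_mul_finrank_boundSpace` (Fulton–Harris Lemma 6.22). [cite: FultonHarrisGTM129, §6.1 Lemma 6.22] -/
theorem perStabInvariants_le_comap (τ : Equiv.Perm (Fin D)) :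
    perStabInvariants k m D ≤ (perStabInvariants k m D).comap (wordPermRep k (m * m) D τ) :=
  fun _ hx => wordPerm_mem_perStabInvariants k m τ hx

variable (k m) in
/-- The representation of `𝔖_D` on the `per`-stabilizer invariants (restriction of `wordPermRep`;
the `𝔖_d`-module structure of `(S_π(E ⊗ F))^{H}`-type invariants in BLMW's proof of Prop. 5.5.2).
[cite: BurgisserEtAl2011, Prop. 5.5.2 (proof)] -/
def perStabInvariantsPermRep : Representation k (Equiv.Perm (Fin D)) (perStabInvariants k m D) :=
  (wordPermRep k (m * m) D).subrepresentation (perStabInvariants k m D) (perStabInvariants_le_comap k m)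

end Family

/-! ### §3 The ceiling -/

section Ceiling

variable (k : Type*) [Field k] [CharZero k] (m d : ℕ)

/-- **The per-side ceiling** `dim boundSpace λ* X_per`: the dimension of the space of
`𝔖_{md}`-invariant coefficient matrices with columns in the weight space of `λ*` (`≅ [λ]`,
`character_transposedPermRep_dualOfPartition`) and rows in the `per`-stabilizer invariants, i.e.
`dim ([λ] ⊗ X_per)^{𝔖_{md}}` — BLMW's `dim (S_λW)^{H}` (proof of Prop. 5.5.2, via (4.1.2)) for the
subgroup `H ⊆ GL(W)(per_m)` generated by the family `IsPerStab`. No closed formula is asserted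
(the printed one, Def. 5.5.1, is the subject of the ERRATUM in `BLMW11StabilityInheritance.lean`).
[cite: BurgisserEtAl2011, Prop. 5.5.2 (proof)] -/
def perOrbitCeiling (lam : Nat.Partition (m * d)) : ℕ :=
  Module.finrank k (boundSpace k (Weight.dualOfPartition (m * m) lam) (perStabInvariants k m (m * d)))

variable {d}

/-- **BLMW 2011, Prop. 5.5.2 (5.5.3), bound-space form (PROVED):** over a field of characteristic
zero, for `m ≥ 1` and a partition `λ ⊢ m·d` with at most `m²` parts, the multiplicity of the
highest weight `λ* = (Weight.dualOfPartition (m*m) λ).toMatIdx` in the coordinate ring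
`k[Δ_m(per_m)]` of the orbit closure of the permanent (`orbitMultiplicity k (paddedPerFormLex k m m) m`)
is at most `perOrbitCeiling k m d λ` — "`ℂ[\overline{GL(W)·per_m}]_δ ⊆ ℂ[GL(W)·per_m]_δ`" with
`mult = dim (S_πW)^{GL(W)(per_m)}` ((4.1.2)), here for the subgroup generated by `IsPerStab`
(a larger, hence still valid, ceiling). Proof: `finrank_highestWeightSpace_orbitCoordRep_le` with
`linSubstRep_reindexGL_paddedPerFormLex_of_isPerStab` and `X = perStabInvariants` (containment
hypothesis `id`); the permanent twin of `orbitMultiplicity_det_le_symKroneckerCoeffRect`.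
[cite: BurgisserEtAl2011, Prop. 5.5.2 (5.5.3)] -/
theorem orbitMultiplicity_per_le_perOrbitCeiling [NeZero m] (lam : Nat.Partition (m * d))
    (hlam : lam.parts.card ≤ m * m) :
    orbitMultiplicity k (paddedPerFormLex k m m) m (Weight.dualOfPartition (m * m) lam).toMatIdx ≤
      perOrbitCeiling k m d lam := by
  have hle := finrank_highestWeightSpace_orbitCoordRep_le (paddedPerFormLex k m m) m
    ((Weight.dualOfPartition (m * m) lam).toMatIdx : Weight (MatIdx m)) (matIdxEquiv m)
    (size_toMatIdx_dualOfPartition m lam hlam) (perStabInvariants k m (m * d)) (IsPerStab k m)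
    (fun _ hx => hx)
    (fun h hh => linSubstRep_reindexGL_paddedPerFormLex_of_isPerStab k m hh)
  rw [toMatIdx_comp_matIdxEquiv] at hle
  exact hle

end Ceiling

/-! ### §4 The structure of the invariants: `X_per ≃ Sym²(X₀)`, `X₀ = (M^{(d^m)})^{𝔚}` -/

section Structure

open PerStab

variable (k : Type*) [Field k] (m D : ℕ)

/-- **The slice space `X₀`**: functions on words of length `D` in the alphabet `Fin m` that are
supported on the words of CONSTANT content (every letter occurring equally often — for `D = m d`
the words of content `(d, …, d)`, a basis of the zero `SL_m`-weight space of `E^{⊗D}`) and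
invariant under relabelling the letters (`y (σ ∘ u) = y u`, the Weyl group `𝔚_E` of permutation
matrices). As an `𝔖_D`-representation this is `((E^{⊗D})_0)^{𝔚_E} ≅ ⊕_μ ((S_μE)_0)^{𝔚_E} ⊗ [μ]`,
BLMW 2011, proof of Prop. 5.5.2 (`X_μ = (S_μE)_0^{𝔚_E}`, `p_μ = dim X_μ`).
[cite: BurgisserEtAl2011, Prop. 5.5.2 (proof)] -/
def perSliceSpace : Submodule k (Word m D → k) where
  carrier := {y | (∀ u : Word m D, (∃ i j : Fin m, wordContent u i ≠ wordContent u j) → y u = 0) ∧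
    ∀ (σ : Equiv.Perm (Fin m)) (u : Word m D), y (⇑σ ∘ u) = y u}
  add_mem' {y y'} hy hy' := ⟨fun u hu => by rw [Pi.add_apply, hy.1 u hu, hy'.1 u hu, add_zero],
    fun σ u => by rw [Pi.add_apply, Pi.add_apply, hy.2, hy'.2]⟩
  zero_mem' := ⟨fun _ _ => rfl, fun _ _ => rfl⟩
  smul_mem' c {y} hy := ⟨fun u hu => by rw [Pi.smul_apply, hy.1 u hu, smul_zero],
    fun σ u => by rw [Pi.smul_apply, Pi.smul_apply, hy.2]⟩

variable {k m D}

/-- Membership in `perSliceSpace` (unfolding lemma). [cite: BurgisserEtAl2011, Prop. 5.5.2 (proof)] -/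
theorem mem_perSliceSpace_iff (y : Word m D → k) :
    y ∈ perSliceSpace k m D ↔
      (∀ u : Word m D, (∃ i j : Fin m, wordContent u i ≠ wordContent u j) → y u = 0) ∧
        ∀ (σ : Equiv.Perm (Fin m)) (u : Word m D), y (⇑σ ∘ u) = y u :=
  Iff.rfl

/-- A non-zero value of a function of `X₀` sits at a word of constant content. [folklore] -/
private theorem wordContent_eq_of_mem_perSliceSpace {y : Word m D → k} (hy : y ∈ perSliceSpace k m D)
    {u : Word m D} (hu : y u ≠ 0) (i j : Fin m) : wordContent u i = wordContent u j := by
  by_contra h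
  exact hu (hy.1 u ⟨i, j, h⟩)

/-- On a word of constant content, `m · content = D`. [folklore] -/
private theorem mul_wordContent_eq_of_forall_eq {u : Word m D} (h : ∀ i j : Fin m, wordContent u i = wordContent u j)
    (i : Fin m) : m * wordContent u i = D := by
  have hs := sum_wordContent u
  rw [Finset.sum_congr rfl fun j _ => h j i, Finset.sum_const, Finset.card_univ, Fintype.card_fin,
    smul_eq_mul] at hs
  exact hs

variable (k) in
/-- `X₀` is stable under the permutations of the positions (content and relabelling are
position-blind; the `𝔖_D`-action commutes with `GL(E)`, Fulton–Harris Lemma 6.22).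
[cite: FultonHarrisGTM129, §6.1 Lemma 6.22] -/
theorem perSliceSpace_le_comap (τ : Equiv.Perm (Fin D)) :
    perSliceSpace k m D ≤ (perSliceSpace k m D).comap (wordPermRep k m D τ) := by
  intro y hy
  refine ⟨fun u hu => ?_, fun σ u => ?_⟩
  · rw [wordPermRep_apply, wordPerm_apply]
    refine hy.1 _ ?_
    obtain ⟨i, j, hij⟩ := hu
    exact ⟨i, j, by rwa [wordContent_comp_perm, wordContent_comp_perm]⟩
  · rw [wordPermRep_apply, wordPerm_apply, wordPerm_apply]
    exact hy.2 σ (u ∘ ⇑τ)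

/-! #### The actions of the family members on functions of pairs of words -/

/-- A diagonal element of `GL_m` acts on functions of words diagonally:
`(diag d · c)(w) = (∏_p d (w p)) c(w)` (`wordRep_diagonal_apply`). [folklore] -/
private theorem wordRep_diagGL_apply (d : Fin m → k) (hd : ∀ i, d i ≠ 0) (c : Word m D → k) (w : Word m D) :
    wordRep k m D (diagGL k m d hd) c w = (∏ p, d (w p)) * c w :=
  wordRep_diagonal_apply k d _ c w

/-- `∏_p scaleAt i c (u p) = c ^ content_i(u)`. [folklore] -/
private theorem prod_scaleAt_comp (i : Fin m) (c : k) (u : Word m D) :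
    ∏ p, scaleAt k m i c (u p) = c ^ wordContent u i := by
  rw [prod_eq_prod_pow_wordContent]
  unfold scaleAt
  rw [Finset.prod_eq_single i (fun j _ hj => by rw [if_neg hj, one_pow])
    (fun h => absurd (Finset.mem_univ i) h), if_pos rfl]

/-- A permutation matrix acts on functions of words by relabelling the letters:
`(P_σ · c)(w) = c (σ ∘ w)`. [folklore] -/
private theorem wordRep_permGL_apply (σ : Equiv.Perm (Fin m)) (c : Word m D → k) (w : Word m D) :
    wordRep k m D (permGL k m σ) c w = c (⇑σ ∘ w) := by
  rw [wordRep_apply, Finset.sum_eq_single (⇑σ ∘ w)]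
  · rw [coe_permGL, Finset.prod_eq_one (fun p _ => by
      rw [permMatrix_apply', Function.comp_apply, if_pos rfl]), one_mul]
  · intro w' _ hw'
    obtain ⟨p, hp⟩ := Function.ne_iff.mp hw'
    rw [coe_permGL, Finset.prod_eq_zero (Finset.mem_univ p), zero_mul]
    rw [permMatrix_apply', if_neg]
    intro h
    exact hp (by rw [Function.comp_apply]; exact h.symm)
  · intro h
    exact absurd (Finset.mem_univ _) h

/-- **`P_σ ⊗ 1` relabels the first word**: `splitFun ((P_σ ⊗ 1) · x) (u, v) = splitFun x (σ ∘ u, v)`.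
[folklore] -/
private theorem splitFun_wordRep_permGL_left (σ : Equiv.Perm (Fin m)) (x : Word (m * m) D → k)
    (u v : Word m D) :
    splitFun k m D (wordRep k (m * m) D (kronFin k m (permGL k m σ) 1) x) (u, v) =
      splitFun k m D x (⇑σ ∘ u, v) := by
  rw [splitFun_wordRep_kronFin_one_right, leftKronAct_apply, wordRep_permGL_apply]

/-- **`1 ⊗ P_σ` relabels the second word**: `splitFun ((1 ⊗ P_σ) · x) (u, v) = splitFun x (u, σ ∘ v)`.
[folklore] -/
private theorem splitFun_wordRep_permGL_right (σ : Equiv.Perm (Fin m)) (x : Word (m * m) D → k)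
    (u v : Word m D) :
    splitFun k m D (wordRep k (m * m) D (kronFin k m 1 (permGL k m σ)) x) (u, v) =
      splitFun k m D x (u, ⇑σ ∘ v) := by
  rw [splitFun_wordRep_kronFin_one_left, rightKronAct_apply, wordRep_permGL_apply]

variable [CharZero k]

/-- **The torus pair acts on functions of pairs of words by `2^{content_i(u) - content_j(v)}`**:
`splitFun (torusPair i j · x) (u, v) = 2^{c_i(u)} (2⁻¹)^{c_j(v)} splitFun x (u, v)`. [folklore] -/
private theorem splitFun_wordRep_torusPair (i j : Fin m) (x : Word (m * m) D → k) (u v : Word m D) :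
    splitFun k m D (wordRep k (m * m) D (torusPair k m i j) x) (u, v) =
      (2 : k) ^ wordContent u i * (2⁻¹ : k) ^ wordContent v j * splitFun k m D x (u, v) := by
  rw [torusPair, splitFun_wordRep_kronFin_eq, leftKronAct_apply, wordRep_diagGL_apply,
    rightKronAct_apply, wordRep_diagGL_apply, prod_scaleAt_comp, prod_scaleAt_comp, mul_assoc]

/-- In characteristic zero `2^a (2⁻¹)^b = 1` forces `a = b`. [folklore] -/
private theorem eq_of_two_pow_mul_inv_two_pow_eq_one {a b : ℕ}
    (h : (2 : k) ^ a * (2⁻¹ : k) ^ b = 1) : a = b := by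
  have h2 : (2 : k) ≠ 0 := two_ne_zero
  have h' : (2 : k) ^ (a : ℤ) = (2 : k) ^ (b : ℤ) := by
    rw [zpow_natCast, zpow_natCast]
    have hb : (2⁻¹ : k) ^ b * 2 ^ b = 1 := by rw [← mul_pow, inv_mul_cancel₀ h2, one_pow]
    calc (2 : k) ^ a = 2 ^ a * ((2⁻¹ : k) ^ b * 2 ^ b) := by rw [hb, mul_one]
      _ = (2 ^ a * (2⁻¹ : k) ^ b) * 2 ^ b := by ring
      _ = 2 ^ b := by rw [h, one_mul]
  exact_mod_cast two_zpow_injective k h'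

/-- **The `per`-stabilizer invariants are the symmetric slice functions with slices in `X₀`**
(the coordinate form of BLMW's `(S_π(E ⊗ F))^{N_E × N_F, τ}` computation in the proof of
Prop. 5.5.2): `x` is fixed by the family `IsPerStab` iff `splitFun x` is symmetric with all rows
and columns in `perSliceSpace`. The torus pairs force `splitFun x (u, v) = 0` unless
`content_i(u) = content_j(v)` for all `i, j` (so both words have constant content); the
permutation matrices give the relabelling invariance of the slices; the transposition gives the
symmetry. [cite: BurgisserEtAl2011, Prop. 5.5.2 (proof)] -/
theorem mem_perStabInvariants_iff_symSlice (x : Word (m * m) D → k) :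
    x ∈ perStabInvariants k m D ↔ splitFun k m D x ∈ symSlice (perSliceSpace k m D) := by
  constructor
  · intro hx
    have hT : ∀ (i j : Fin m) (u v : Word m D), wordContent u i ≠ wordContent v j →
        splitFun k m D x (u, v) = 0 := by
      intro i j u v hne
      have h := congr_fun (congrArg (splitFun k m D) (hx _ (Or.inl ⟨i, j, rfl⟩))) (u, v)
      rw [splitFun_wordRep_torusPair] at h
      by_contra hne0
      have h1 : (2 : k) ^ wordContent u i * (2⁻¹ : k) ^ wordContent v j = 1 :=
        mul_right_cancel₀ hne0 (by rw [h, one_mul])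
      exact hne (eq_of_two_pow_mul_inv_two_pow_eq_one h1)
    have hR : ∀ (σ : Equiv.Perm (Fin m)) (u v : Word m D),
        splitFun k m D x (⇑σ ∘ u, v) = splitFun k m D x (u, v) := fun σ u v => by
      have h := congr_fun (congrArg (splitFun k m D) (hx _ (Or.inr (Or.inl ⟨σ, rfl⟩)))) (u, v)
      rwa [splitFun_wordRep_permGL_left] at h
    have hC : ∀ (σ : Equiv.Perm (Fin m)) (u v : Word m D),
        splitFun k m D x (u, ⇑σ ∘ v) = splitFun k m D x (u, v) := fun σ u v => by
      have h := congr_fun (congrArg (splitFun k m D) (hx _ (Or.inr (Or.inr (Or.inl ⟨σ, rfl⟩))))) (u, v)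
      rwa [splitFun_wordRep_permGL_right] at h
    have hS : ∀ p : Word m D × Word m D, splitFun k m D x p.swap = splitFun k m D x p := fun p => by
      have h := congr_fun (congrArg (splitFun k m D) (hx _ (Or.inr (Or.inr (Or.inr rfl))))) p
      rwa [splitFun_wordRep_swapGL] at h
    refine ⟨⟨fun v => ⟨fun u ⟨i, j, hij⟩ => ?_, fun σ u => hR σ u v⟩,
      fun u => ⟨fun v ⟨i, j, hij⟩ => ?_, fun σ v => hC σ u v⟩⟩, hS⟩
    · -- column slice supported on constant-content words
      by_contra h0
      exact hij ((show wordContent u i = wordContent v i from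
        not_ne_iff.mp fun hne => h0 (hT i i u v hne)).trans
        (not_ne_iff.mp fun hne => h0 (hT j i u v hne)).symm)
    · by_contra h0
      exact hij ((show wordContent v i = wordContent u i from
        (not_ne_iff.mp fun hne => h0 (hT i i u v hne)).symm).trans
        (not_ne_iff.mp fun hne => h0 (hT i j u v hne)))
  · rintro ⟨⟨hcol, hrow⟩, hsym⟩ h hh
    apply (splitFun k m D).injective
    funext p
    obtain ⟨u, v⟩ := p
    rcases hh with ⟨i, j, rfl⟩ | ⟨σ, rfl⟩ | ⟨σ, rfl⟩ | rfl
    · rw [splitFun_wordRep_torusPair]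
      by_cases h0 : splitFun k m D x (u, v) = 0
      · rw [h0, mul_zero]
      · -- both words have constant content, hence `content_i(u) = content_j(v)`
        have hu : ∀ a b : Fin m, wordContent u a = wordContent u b :=
          fun a b => wordContent_eq_of_mem_perSliceSpace (hcol v) h0 a b
        have hv : ∀ a b : Fin m, wordContent v a = wordContent v b :=
          fun a b => wordContent_eq_of_mem_perSliceSpace (hrow u) h0 a b
        have hm : m ≠ 0 := Nat.pos_iff_ne_zero.mp (Fin.pos i)
        have hij : wordContent u i = wordContent v j := by
          apply Nat.eq_of_mul_eq_mul_left (Nat.pos_of_ne_zero hm)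
          rw [mul_wordContent_eq_of_forall_eq hu i, mul_wordContent_eq_of_forall_eq hv j]
        rw [hij, ← mul_pow, mul_inv_cancel₀ (two_ne_zero : (2 : k) ≠ 0), one_pow, one_mul]
    · rw [splitFun_wordRep_permGL_left]
      exact (hcol v).2 σ u
    · rw [splitFun_wordRep_permGL_right]
      exact (hrow u).2 σ v
    · rw [splitFun_wordRep_swapGL]
      exact hsym (u, v)

variable (k m D)

/-- **`X_per ≃ Sym²(X₀)` (linear)**: the splitting of bi-words identifies the `per`-stabilizer
invariants with the symmetric slice functions over `perSliceSpace`
(`mem_perStabInvariants_iff_symSlice`). [cite: BurgisserEtAl2011, Prop. 5.5.2 (proof)] -/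
def perStabInvariantsEquivSymSliceLinear :
    perStabInvariants k m D ≃ₗ[k] symSlice (perSliceSpace k m D) where
  toFun x := ⟨splitFun k m D x, (mem_perStabInvariants_iff_symSlice (x : Word (m * m) D → k)).mp x.2⟩
  invFun M := ⟨(splitFun k m D).symm M, by
    rw [mem_perStabInvariants_iff_symSlice, LinearEquiv.apply_symm_apply]
    exact M.2⟩
  map_add' _ _ := rfl
  map_smul' _ _ := rfl
  left_inv x := Subtype.ext ((splitFun k m D).symm_apply_apply _)
  right_inv M := Subtype.ext ((splitFun k m D).apply_symm_apply _)

/-- **`X_per ≃ Sym²(X₀)` as representations of `𝔖_D`** (the splitting is `𝔖_D`-equivariant,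
`splitFun_wordPerm`): BLMW 2011, proof of Prop. 5.5.2 — "the space of `τ`-invariants of
`(S_π(E ⊗ F))^{N_E × N_F}`", in coordinates and with the full fixed space
`Sym²X_μ ⊗ (K^π_{μμ})^+ ⊕ Λ²X_μ ⊗ (K^π_{μμ})^-` (no summand dropped).
[cite: BurgisserEtAl2011, Prop. 5.5.2 (proof)] -/
def perStabInvariantsEquivSymSlice :
    (perStabInvariantsPermRep k m (D := D)).Equiv
      ((pairRep (wordPermRep k m D) (wordPermRep k m D)).subrepresentation
        (symSlice (perSliceSpace k m D)) (symSlice_le_comap (perSliceSpace_le_comap k))) :=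
  Representation.Equiv.mk (perStabInvariantsEquivSymSliceLinear k m D) fun τ => by
    apply LinearMap.ext
    intro x
    apply Subtype.ext
    change splitFun k m D (wordPerm k τ x) =
      pairRep (wordPermRep k m D) (wordPermRep k m D) τ (splitFun k m D x)
    rw [splitFun_wordPerm, pairRep_wordPermRep_apply]

/-- **The character of the `per`-stabilizer invariants**: `2 · χ_{X_per}(τ) = χ₀(τ)² + χ₀(τ²)`,
`χ₀` the character of `𝔖_D` on `X₀ = perSliceSpace` (`perStabInvariantsEquivSymSlice` and the
symmetric-square character formula `two_mul_character_symSlice`, Fulton–Harris §2.1 Ex. 2.2).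
With `X₀ ≅ ⊕_μ X_μ ⊗ [μ]` (`dim X_μ = p_μ`) this is the dimension count of BLMW's proof of
Prop. 5.5.2, Λ²-summand included. [cite: BurgisserEtAl2011, Prop. 5.5.2 (proof)] -/
theorem two_mul_character_perStabInvariantsPermRep (τ : Equiv.Perm (Fin D)) :
    2 * ((wordPermRep k (m * m) D).subrepresentation (perStabInvariants k m D)
        (perStabInvariants_le_comap k m)).character τ =
      ((wordPermRep k m D).subrepresentation (perSliceSpace k m D) (perSliceSpace_le_comap k)).character τ ^ 2 +
        ((wordPermRep k m D).subrepresentation (perSliceSpace k m D) (perSliceSpace_le_comap k)).character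
          (τ * τ) := by
  have hiso : ((wordPermRep k (m * m) D).subrepresentation (perStabInvariants k m D)
      (perStabInvariants_le_comap k m)).character =
      ((pairRep (wordPermRep k m D) (wordPermRep k m D)).subrepresentation
        (symSlice (perSliceSpace k m D)) (symSlice_le_comap (perSliceSpace_le_comap k))).character :=
    Representation.char_iso (perStabInvariantsEquivSymSlice k m D)
  rw [hiso, two_mul_character_symSlice (perSliceSpace_le_comap k) τ]

variable {D} in
/-- **Character formula for the per-side ceiling** (characteristic zero, `ℓ(λ) ≤ m²`):
`2 · (md)! · perOrbitCeiling λ = ∑_{τ ∈ 𝔖_{md}} χ^λ(τ) (χ₀(τ)² + χ₀(τ²))`, `χ₀` the character of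
`𝔖_{md}` on `X₀ = perSliceSpace k m (m d)` — `(md)! · dim T = ∑_τ χ^λ(τ) χ_{X_per}(τ)`
(`card_mul_finrank_boundSpace`, Fulton–Harris (2.9)) and `2 χ_{X_per} = χ₀² + χ₀(·²)`. The
permanent twin of `two_mul_factorial_mul_symKroneckerCoeffRect` (where `χ₀ = χ^□`); here
`χ₀ = ∑_μ p_μ χ^μ` by Cor. 8.4.2 (not used). [cite: BurgisserEtAl2011, Prop. 5.5.2 (proof)] -/
theorem two_mul_factorial_mul_perOrbitCeiling {d : ℕ} (lam : Nat.Partition (m * d))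
    (hlam : lam.parts.card ≤ m * m) :
    ((2 * (m * d).factorial * perOrbitCeiling k m d lam : ℕ) : k) =
      ∑ τ : Equiv.Perm (Fin (m * d)), spechtCharacter k lam τ *
        (((wordPermRep k m (m * d)).subrepresentation (perSliceSpace k m (m * d))
            (perSliceSpace_le_comap k)).character τ ^ 2 +
          ((wordPermRep k m (m * d)).subrepresentation (perSliceSpace k m (m * d))
            (perSliceSpace_le_comap k)).character (τ * τ)) := by
  have hcount : (((m * d).factorial : ℕ) : k) * (perOrbitCeiling k m d lam : k) =
      ∑ τ : Equiv.Perm (Fin (m * d)), spechtCharacter k lam τ *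
        ((wordPermRep k (m * m) (m * d)).subrepresentation (perStabInvariants k m (m * d))
          (perStabInvariants_le_comap k m)).character τ := by
    have h := card_mul_finrank_boundSpace k (Weight.dualOfPartition (m * m) lam)
      (perStabInvariants k m (m * d)) (perStabInvariants_le_comap k m)
    rw [Fintype.card_perm, Fintype.card_fin,
      character_transposedPermRep_dualOfPartition k lam hlam] at h
    exact h
  push_cast
  rw [mul_assoc, hcount, Finset.mul_sum]
  refine Finset.sum_congr rfl fun τ _ => ?_
  rw [mul_left_comm, two_mul_character_perStabInvariantsPermRep k m (m * d) τ]

end Structure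

/-! ### §5 The family computes the full stabilizer invariants (Marcus–May); `perOrbitCeiling = dim {λ}^{H_per}` -/

section FullStabilizer

open IK2020 PerStab

variable (k : Type*) [Field k] [CharZero k] (m : ℕ)

/-- **Stabilizer-fixed words are family-fixed** (any field of characteristic zero): the vectors of
`W^{⊗D}` fixed by the whole stabilizer `H_per = stab(per_m)` (pulled back to `GL_{m²}` along
`matIdxEquiv`) lie in `perStabInvariants` (every family element is in `H_per`,
`linSubstRep_reindexGL_paddedPerFormLex_of_isPerStab`). [cite: BurgisserEtAl2011, Prop. 5.5.2 (proof)] -/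
theorem invariants_stabilizer_le_perStabInvariants [NeZero m] (D : ℕ) :
    Representation.invariants ((wordRep k (m * m) D).comp
        ((linStabilizer (paddedPerFormLex k m m)).comap (reindexGL (k := k) (matIdxEquiv m))).subtype) ≤
      perStabInvariants k m D := by
  intro x hx h hh
  rw [Representation.mem_invariants] at hx
  have hmem : reindexGL (matIdxEquiv m) h ∈ linStabilizer (paddedPerFormLex k m m) := by
    rw [mem_linStabilizer]
    exact linSubstRep_reindexGL_paddedPerFormLex_of_isPerStab k m hh
  exact hx ⟨h, hmem⟩

/-- **`dim {λ}^{H_per} ≤ perOrbitCeiling λ`** (any field of characteristic zero, `ℓ(λ) ≤ m²`): by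
Ikenmeyer–Kandasamy's `dim T_H = dim {λ}^H` (`IK2020.finrank_boundSpace_invariants_eq_weylInvariantDim`)
and `T_{H_per} ⊆ T_{family}`; the permanent twin of `IK2020.weylInvariantDim_det_le_symKroneckerCoeffRect`.
BLMW 2011 (5.5.2) via (4.1.2): `dim (S_πW)^{GL(W)(per_m)}` is the orbit-ring multiplicity.
[cite: BurgisserEtAl2011, Prop. 5.5.2 (5.5.2)] -/
theorem weylInvariantDim_per_le_perOrbitCeiling [NeZero m] {d : ℕ} (lam : Nat.Partition (m * d))
    (hlam : lam.parts.card ≤ m * m) :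
    weylInvariantDim k (m * m) lam
        ((linStabilizer (paddedPerFormLex k m m)).comap (reindexGL (k := k) (matIdxEquiv m))) ≤
      perOrbitCeiling k m d lam := by
  rw [← finrank_boundSpace_invariants_eq_weylInvariantDim k _ lam hlam]
  refine Submodule.finrank_mono fun L hL => ⟨hL.1, hL.2.1, fun I => ?_⟩
  exact invariants_stabilizer_le_perStabInvariants k m (m * d) (hL.2.2 I)

/-! #### The reverse inclusion over `ℂ` for `m ≥ 3` (Marcus–May) -/

omit [CharZero k] in
/-- A monomial matrix acts on functions of words by a weighted relabelling: if
`γ_{ij} = [i = θ j] c_j` then `(γ · x)(w') = (∏_p c(θ⁻¹ w'_p)) · x(θ⁻¹ ∘ w')`. [folklore] -/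
private theorem wordRep_apply_of_monomial {N D : ℕ} (γ : GL (Fin N) k) (θ : Equiv.Perm (Fin N))
    (c : Fin N → k) (hγ : ∀ i j, (γ : Matrix (Fin N) (Fin N) k) i j = if i = θ j then c j else 0)
    (x : Word N D → k) (w' : Word N D) :
    wordRep k N D γ x w' = (∏ p, c (θ.symm (w' p))) * x (⇑θ.symm ∘ w') := by
  rw [wordRep_apply, Finset.sum_eq_single (⇑θ.symm ∘ w')]
  · congr 1
    refine Finset.prod_congr rfl fun p _ => ?_
    rw [hγ, Function.comp_apply, Equiv.apply_symm_apply, if_pos rfl]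
  · intro w _ hw
    obtain ⟨p, hp⟩ := Function.ne_iff.mp hw
    rw [Finset.prod_eq_zero (Finset.mem_univ p), zero_mul]
    rw [hγ, if_neg]
    intro h
    apply hp
    rw [Function.comp_apply, h, Equiv.symm_apply_apply]
  · intro h
    exact absurd (Finset.mem_univ _) h

/-- Entries of a monomial sandwich (Marcus–May's `D P_π X P_ρ L`; private copy of the two-line
computation of `CharacterizedByStabilizerSL.lean`). [folklore] -/
private theorem sandwich_apply' {ι R : Type*} [Fintype ι] [DecidableEq ι] [CommRing R]
    (d l : ι → R) (π ρ : Equiv.Perm ι) (X : Matrix ι ι R) (a b : ι) :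
    (Matrix.diagonal d * π.permMatrix R * X * ρ.permMatrix R * Matrix.diagonal l) a b =
      d a * X (π a) (ρ.symm b) * l b := by
  rw [Matrix.mul_diagonal, PEquiv.mul_toMatrix_toPEquiv, Matrix.submatrix_apply, id,
    Matrix.mul_assoc, Matrix.diagonal_mul, PEquiv.toMatrix_toPEquiv_mul, Matrix.submatrix_apply, id]

/-- Reading off the entries of `A` from `mat(Aᵀ x) = D P_π mat(x) P_ρ L` (test with the indicator
vectors): `A_{q' q} = [q' = (π q₁, ρ⁻¹ q₂)] d_{q₁} l_{q₂}`. [folklore] -/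
private theorem entry_of_sandwich {A : Matrix (Fin m × Fin m) (Fin m × Fin m) ℂ}
    {π ρ : Equiv.Perm (Fin m)} {d l : Fin m → ℂ}
    (hM : ∀ x : Fin m × Fin m → ℂ, (Matrix.of fun a b => (Aᵀ *ᵥ x) (a, b)) =
      Matrix.diagonal d * π.permMatrix ℂ * (Matrix.of fun a b => x (a, b)) * ρ.permMatrix ℂ *
        Matrix.diagonal l) (q' q : Fin m × Fin m) :
    A q' q = if q' = Equiv.prodCongr π ρ.symm q then d q.1 * l q.2 else 0 := by
  have h := congr_fun (congr_fun (hM (Pi.single q' 1)) q.1) q.2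
  rw [Matrix.of_apply, sandwich_apply', Matrix.of_apply, Matrix.mulVec, dotProduct] at h
  simp only [Matrix.transpose_apply, Pi.single_apply, mul_ite, mul_one, mul_zero,
    Finset.sum_ite_eq', Finset.mem_univ, if_true, Prod.mk.eta] at h
  rw [h]
  have hθ : (Equiv.prodCongr π ρ.symm) q = (π q.1, ρ.symm q.2) := rfl
  rw [hθ]
  by_cases hq : q' = (π q.1, ρ.symm q.2)
  · rw [if_pos hq.symm, if_pos hq]
  · rw [if_neg (Ne.symm hq), if_neg hq, zero_mul]

/-- The transposed case: `mat(Aᵀ x) = D P_π mat(x)ᵀ P_ρ L` gives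
`A_{q' q} = [q' = (ρ⁻¹ q₂, π q₁)] d_{q₁} l_{q₂}`. [folklore] -/
private theorem entry_of_sandwich_transpose {A : Matrix (Fin m × Fin m) (Fin m × Fin m) ℂ}
    {π ρ : Equiv.Perm (Fin m)} {d l : Fin m → ℂ}
    (hM : ∀ x : Fin m × Fin m → ℂ, (Matrix.of fun a b => (Aᵀ *ᵥ x) (a, b)) =
      Matrix.diagonal d * π.permMatrix ℂ * (Matrix.of fun a b => x (a, b))ᵀ * ρ.permMatrix ℂ *
        Matrix.diagonal l) (q' q : Fin m × Fin m) :
    A q' q = if q' = ((Equiv.prodCongr π ρ.symm).trans (Equiv.prodComm _ _)) q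
      then d q.1 * l q.2 else 0 := by
  have h := congr_fun (congr_fun (hM (Pi.single q' 1)) q.1) q.2
  rw [Matrix.of_apply, sandwich_apply', Matrix.transpose_apply, Matrix.of_apply, Matrix.mulVec,
    dotProduct] at h
  simp only [Matrix.transpose_apply, Pi.single_apply, mul_ite, mul_one, mul_zero,
    Finset.sum_ite_eq', Finset.mem_univ, if_true, Prod.mk.eta] at h
  rw [h]
  have hθ : ((Equiv.prodCongr π ρ.symm).trans (Equiv.prodComm _ _)) q = (ρ.symm q.2, π q.1) := rfl
  rw [hθ]
  by_cases hq : q' = (ρ.symm q.2, π q.1)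
  · rw [if_pos hq.symm, if_pos hq]
  · rw [if_neg (Ne.symm hq), if_neg hq, zero_mul]

variable {m} in
/-- From the stabilizer of `per_m` in the lexicographic variables (pulled back to `GL_{m²}`) to
Marcus–May's hypothesis: the matrix `A = γ ∘ (e × e)`, `e = finProdFinEquiv`, fixes `per_m` under
`linSubst` (`rename_linSubst` along `toLex`). [folklore] -/
private theorem linSubst_submatrix_perPoly_of_mem [NeZero m] {γ : GL (Fin (m * m)) ℂ}
    (hγ : reindexGL (k := ℂ) (matIdxEquiv m) γ ∈ linStabilizer (paddedPerFormLex ℂ m m)) :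
    linSubst (Fin m × Fin m) ℂ
        ((γ : Matrix (Fin (m * m)) (Fin (m * m)) ℂ).submatrix finProdFinEquiv finProdFinEquiv)
        (perPoly (Fin m) ℂ) = perPoly (Fin m) ℂ := by
  set A := (γ : Matrix (Fin (m * m)) (Fin (m * m)) ℂ).submatrix finProdFinEquiv finProdFinEquiv
    with hA
  rw [mem_linStabilizer, linSubstRep_apply, coe_reindexGL, paddedPerFormLex_self] at hγ
  have hre : Matrix.reindex (toLex : Fin m × Fin m ≃ MatIdx m) toLex A =
      (γ : Matrix (Fin (m * m)) (Fin (m * m)) ℂ).submatrix ⇑(matIdxEquiv m).symm ⇑(matIdxEquiv m).symm := by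
    ext x y
    obtain ⟨⟨i, j⟩, rfl⟩ := (toLex : Fin m × Fin m ≃ MatIdx m).surjective x
    obtain ⟨⟨i', j'⟩, rfl⟩ := (toLex : Fin m × Fin m ≃ MatIdx m).surjective y
    rw [Matrix.reindex_apply, Matrix.submatrix_apply, Matrix.submatrix_apply, Equiv.symm_apply_apply,
      Equiv.symm_apply_apply, hA, Matrix.submatrix_apply, matIdxEquiv_symm_toLex,
      matIdxEquiv_symm_toLex]
  have h := rename_linSubst (toLex : Fin m × Fin m ≃ MatIdx m) A (perPoly (Fin m) ℂ)
  rw [hre, hγ] at h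
  exact rename_injective _ (toLex : Fin m × Fin m ≃ MatIdx m).injective h

variable {m} in
/-- Relabelling invariance of a symmetric slice function with slices in `X₀`:
`M (σ ∘ u, τ ∘ v) = M (u, v)`. [folklore] -/
private theorem symSlice_relabel {D : ℕ} {M : Word m D × Word m D → ℂ}
    (hM : M ∈ symSlice (perSliceSpace ℂ m D)) (σ τ : Equiv.Perm (Fin m)) (u v : Word m D) :
    M (⇑σ ∘ u, ⇑τ ∘ v) = M (u, v) := by
  have h1 := (hM.1.1 (⇑τ ∘ v)).2 σ u
  have h2 := (hM.1.2 u).2 τ v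
  dsimp only at h1 h2
  rw [h1, h2]

variable {m} in
/-- On the support of a symmetric slice function with slices in `X₀` both words have the same
constant content, so a torus pair with `(∏ d)(∏ l) = 1` acts trivially:
`(∏_p d(u_p)) (∏_p l(v_p)) = 1`. [folklore] -/
private theorem prod_weights_eq_one_of_ne_zero {D : ℕ} {M : Word m D × Word m D → ℂ}
    (hM : M ∈ symSlice (perSliceSpace ℂ m D)) {d l : Fin m → ℂ} (hdl : (∏ i, d i) * ∏ i, l i = 1)
    {u v : Word m D} (huv : M (u, v) ≠ 0) :
    (∏ p, d (u p)) * ∏ p, l (v p) = 1 := by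
  have hu : ∀ a b : Fin m, wordContent u a = wordContent u b :=
    fun a b => wordContent_eq_of_mem_perSliceSpace (hM.1.1 v) huv a b
  have hv : ∀ a b : Fin m, wordContent v a = wordContent v b :=
    fun a b => wordContent_eq_of_mem_perSliceSpace (hM.1.2 u) huv a b
  rcases isEmpty_or_nonempty (Fin D) with hD | ⟨⟨p₀⟩⟩
  · simp
  rcases Nat.eq_zero_or_pos m with hm0 | hmpos
  · subst hm0
    exact (u p₀).elim0
  · set i₀ : Fin m := ⟨0, hmpos⟩
    have huv' : ∀ j : Fin m, wordContent v j = wordContent u i₀ := fun j => by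
      apply Nat.eq_of_mul_eq_mul_left hmpos
      rw [mul_wordContent_eq_of_forall_eq hv j, mul_wordContent_eq_of_forall_eq hu i₀]
    have hd : (∏ p, d (u p)) = (∏ i, d i) ^ wordContent u i₀ := by
      rw [prod_eq_prod_pow_wordContent d u, ← Finset.prod_pow]
      exact Finset.prod_congr rfl fun i _ => by rw [hu i i₀]
    have hl : (∏ p, l (v p)) = (∏ i, l i) ^ wordContent u i₀ := by
      rw [prod_eq_prod_pow_wordContent l v, ← Finset.prod_pow]
      exact Finset.prod_congr rfl fun j _ => by rw [huv' j]
    rw [hd, hl, ← mul_pow, hdl, one_pow]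

/-- **Every element of the stabilizer of `per_m` (`m ≥ 3`, over `ℂ`) fixes the family-fixed
vectors**: by Marcus–May (`marcusMay1962_perPreserver_sandwich_holds`) a stabilizer element is a
monomial sandwich `X ↦ D P_π X P_ρ L` or `X ↦ D P_π Xᵀ P_ρ L` with `(∏ d)(∏ l) = 1`, i.e. a monomial
matrix on bi-letters, which acts on functions of bi-words by relabelling rows and columns (and
transposing) times the weight `∏ d(u_p) l(v_p) = 1` on the support (constant contents). BLMW 2011
(5.5.1), proof of Prop. 5.5.2 (`(S_π(E ⊗ F))^{N_E × N_F, τ}`). [cite: BurgisserEtAl2011, §5.5 (5.5.1)] -/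
theorem wordRep_eq_self_of_mem_perStabInvariants [NeZero m] (hm : 3 ≤ m) {D : ℕ}
    {x : Word (m * m) D → ℂ} (hx : x ∈ perStabInvariants ℂ m D) {γ : GL (Fin (m * m)) ℂ}
    (hγ : reindexGL (k := ℂ) (matIdxEquiv m) γ ∈ linStabilizer (paddedPerFormLex ℂ m m)) :
    wordRep ℂ (m * m) D γ x = x := by
  have hMx := (mem_perStabInvariants_iff_symSlice x).mp hx
  obtain ⟨π, ρ, d, l, hdl, hcase⟩ :=
    marcusMay1962_perPreserver_sandwich_holds m hm _ (linSubst_submatrix_perPoly_of_mem hγ)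
  set f : Fin m × Fin m ≃ Fin (m * m) := finProdFinEquiv with hf
  -- the weight attached to a bi-letter
  set c : Fin (m * m) → ℂ := fun j => d (f.symm j).1 * l (f.symm j).2 with hc
  -- common final step: a monomial `γ` with permutation `f θ f⁻¹` and weights `c`
  have key : ∀ θ : Equiv.Perm (Fin m × Fin m),
      (∀ q' q : Fin m × Fin m, (γ : Matrix (Fin (m * m)) (Fin (m * m)) ℂ) (f q') (f q) =
        if q' = θ q then d q.1 * l q.2 else 0) →
      (∀ u' v' : Word m D, x (fun p => f (θ.symm (u' p, v' p))) = splitFun ℂ m D x (u', v')) →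
      (∀ u' v' : Word m D, splitFun ℂ m D x (u', v') ≠ 0 →
        (∏ p, c (f (θ.symm (u' p, v' p)))) = 1) →
      wordRep ℂ (m * m) D γ x = x := by
    intro θ hentry hrel hwt
    have hγ' : ∀ i j, (γ : Matrix (Fin (m * m)) (Fin (m * m)) ℂ) i j =
        if i = (f.permCongr θ) j then c j else 0 := by
      intro i j
      have h := hentry (f.symm i) (f.symm j)
      rw [Equiv.apply_symm_apply, Equiv.apply_symm_apply] at h
      rw [h, Equiv.permCongr_apply, hc]
      by_cases hij : f.symm i = θ (f.symm j)
      · rw [if_pos hij, if_pos (by rw [← hij, Equiv.apply_symm_apply])]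
      · rw [if_neg hij, if_neg (fun h' => hij (by rw [h', Equiv.symm_apply_apply]))]
    -- `(f θ f⁻¹)⁻¹ = f θ⁻¹ f⁻¹` pointwise
    have hsymm : ∀ i : Fin (m * m), (f.permCongr θ).symm i = f (θ.symm (f.symm i)) := fun i => rfl
    funext w'
    rw [wordRep_apply_of_monomial ℂ γ (f.permCongr θ) c hγ' x w']
    -- the split form of `w'` and of `θ⁻¹ ∘ w'`
    set u' : Word m D := ((splitWord m D) w').1 with hu'
    set v' : Word m D := ((splitWord m D) w').2 with hv'
    have hw' : w' = (splitWord m D).symm (u', v') := ((splitWord m D).symm_apply_apply w').symm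
    have hfw : ∀ p, f.symm (w' p) = (u' p, v' p) := fun p => rfl
    have hθw : (⇑(f.permCongr θ).symm ∘ w') = fun p => f (θ.symm (u' p, v' p)) := by
      funext p
      rw [Function.comp_apply, hsymm, hfw]
    have hxw : x (⇑(f.permCongr θ).symm ∘ w') = x w' := by
      rw [hθw, hrel u' v', splitFun_apply, ← hw']
    rw [hxw]
    by_cases h0 : x w' = 0
    · rw [h0, mul_zero]
    · have h0' : splitFun ℂ m D x (u', v') ≠ 0 := by rwa [splitFun_apply, ← hw']
      have hprod : (∏ p, c ((f.permCongr θ).symm (w' p))) = ∏ p, c (f (θ.symm (u' p, v' p))) := by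
        refine Finset.prod_congr rfl fun p _ => ?_
        rw [hsymm, hfw]
      rw [hprod, hwt u' v' h0', one_mul]
  rcases hcase with hM | hM
  · -- `X ↦ D P_π X P_ρ L`: `θ (a, b) = (π a, ρ⁻¹ b)`
    refine key (Equiv.prodCongr π ρ.symm) (fun q' q => ?_) (fun u' v' => ?_) (fun u' v' h0 => ?_)
    · rw [← entry_of_sandwich m hM q' q, Matrix.submatrix_apply]
    · have h : (fun p => f ((Equiv.prodCongr π ρ.symm).symm (u' p, v' p))) =
          (splitWord m D).symm (⇑π.symm ∘ u', ⇑ρ ∘ v') := by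
        funext p
        rw [splitWord_symm_apply]
        rfl
      rw [h, ← splitFun_apply ℂ m D x (⇑π.symm ∘ u', ⇑ρ ∘ v')]
      exact symSlice_relabel hMx π.symm ρ u' v'
    · have h : (∏ p, c (f ((Equiv.prodCongr π ρ.symm).symm (u' p, v' p)))) =
          (∏ p, d ((⇑π.symm ∘ u') p)) * ∏ p, l ((⇑ρ ∘ v') p) := by
        rw [← Finset.prod_mul_distrib]
        refine Finset.prod_congr rfl fun p _ => ?_
        rw [hc]
        dsimp only
        rw [Equiv.symm_apply_apply]
        rfl
      rw [h]
      refine prod_weights_eq_one_of_ne_zero hMx hdl ?_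
      rwa [symSlice_relabel hMx π.symm ρ u' v']
  · -- `X ↦ D P_π Xᵀ P_ρ L`: `θ (a, b) = (ρ⁻¹ b, π a)`
    refine key ((Equiv.prodCongr π ρ.symm).trans (Equiv.prodComm _ _)) (fun q' q => ?_)
      (fun u' v' => ?_) (fun u' v' h0 => ?_)
    · rw [← entry_of_sandwich_transpose m hM q' q, Matrix.submatrix_apply]
    · have h : (fun p => f (((Equiv.prodCongr π ρ.symm).trans (Equiv.prodComm _ _)).symm (u' p, v' p))) =
          (splitWord m D).symm (⇑π.symm ∘ v', ⇑ρ ∘ u') := by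
        funext p
        rw [splitWord_symm_apply]
        rfl
      rw [h, ← splitFun_apply ℂ m D x (⇑π.symm ∘ v', ⇑ρ ∘ u'), symSlice_relabel hMx π.symm ρ v' u']
      exact hMx.2 (u', v')
    · have h : (∏ p, c (f (((Equiv.prodCongr π ρ.symm).trans (Equiv.prodComm _ _)).symm
          (u' p, v' p)))) = (∏ p, d ((⇑π.symm ∘ v') p)) * ∏ p, l ((⇑ρ ∘ u') p) := by
        rw [← Finset.prod_mul_distrib]
        refine Finset.prod_congr rfl fun p _ => ?_
        rw [hc]
        dsimp only
        rw [Equiv.symm_apply_apply]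
        rfl
      rw [h]
      refine prod_weights_eq_one_of_ne_zero hMx hdl ?_
      rw [symSlice_relabel hMx π.symm ρ v' u']
      have hs := hMx.2 (u', v')
      rw [Prod.swap_prod_mk] at hs
      rwa [hs]

/-- **`X_per = (W^{⊗D})^{H_per}`** over `ℂ`, `m ≥ 3`: the explicit family `IsPerStab` has the same
fixed vectors in `W^{⊗D}` as the whole stabilizer of `per_m` (Marcus–May). [cite: BurgisserEtAl2011, §5.5 (5.5.1)] -/
theorem perStabInvariants_eq_invariants_stabilizer [NeZero m] (hm : 3 ≤ m) (D : ℕ) :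
    perStabInvariants ℂ m D =
      Representation.invariants ((wordRep ℂ (m * m) D).comp
        ((linStabilizer (paddedPerFormLex ℂ m m)).comap (reindexGL (k := ℂ) (matIdxEquiv m))).subtype) := by
  refine le_antisymm (fun x hx => ?_) (invariants_stabilizer_le_perStabInvariants ℂ m D)
  rw [Representation.mem_invariants]
  rintro ⟨γ, hγ⟩
  exact wordRep_eq_self_of_mem_perStabInvariants m hm hx (Subgroup.mem_comap.mp hγ)

/-- **`perOrbitCeiling λ = dim {λ}^{H_per}`** over `ℂ` for `m ≥ 3`, `ℓ(λ) ≤ m²`: the per-side ceiling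
IS the dimension of the stabilizer invariants of the Weyl module — BLMW's multiplicity of `S_λW^*`
in the ORBIT ring `ℂ[GL(W)·per_m]` by (4.1.2), in the `Fin (m²)`-indexed Weyl-module rendering of
Ikenmeyer–Kandasamy (`IK2020.weylInvariantDim`). With `two_mul_factorial_mul_perOrbitCeiling` this
gives the character formula `2·(md)!·dim {λ}^{H_per} = ∑_τ χ^λ(τ)(χ₀(τ)² + χ₀(τ²))` for the quantity
of (5.5.2) (the corrected count; the printed `mult_π` is the subject of the ERRATUM in
`BLMW11StabilityInheritance.lean`, and its identification with this number still needs Cor. 8.4.2).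
[cite: BurgisserEtAl2011, Prop. 5.5.2 (5.5.2)] -/
theorem perOrbitCeiling_eq_weylInvariantDim [NeZero m] (hm : 3 ≤ m) {d : ℕ}
    (lam : Nat.Partition (m * d)) (hlam : lam.parts.card ≤ m * m) :
    perOrbitCeiling ℂ m d lam =
      weylInvariantDim ℂ (m * m) lam
        ((linStabilizer (paddedPerFormLex ℂ m m)).comap (reindexGL (k := ℂ) (matIdxEquiv m))) := by
  rw [← finrank_boundSpace_invariants_eq_weylInvariantDim ℂ _ lam hlam, perOrbitCeiling,
    perStabInvariants_eq_invariants_stabilizer m hm]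

/-- **The orbit-ring multiplicity of the permanent, character form (PROVED; BLMW 2011 (5.5.2)
corrected):** over `ℂ`, for `m ≥ 3` and `λ ⊢ m·d` with `ℓ(λ) ≤ m²`,
`2 · (md)! · dim {λ}^{H_per} = ∑_{τ ∈ 𝔖_{md}} χ^λ(τ) (χ₀(τ)² + χ₀(τ²))`, `χ₀` the character of
`𝔖_{md}` on `X₀ = perSliceSpace ℂ m (md)` (`= ((E^{⊗md})_0)^{𝔚_E} ≅ ⊕_μ X_μ ⊗ [μ]`,
`dim X_μ = p_μ`). Expanding `χ₀ = ∑_μ p_μ χ^μ` turns the right side into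
`2·(md)!·(½ ∑_{μ≠ν} k_{λμν} p_μ p_ν + ∑_μ [sk^λ_{μμ} C(p_μ+1,2) + (k_{λμμ} - sk^λ_{μμ}) C(p_μ,2)])`,
BLMW's count WITH the omitted `Λ²` summand. [cite: BurgisserEtAl2011, Prop. 5.5.2 (5.5.2)] -/
theorem two_mul_factorial_mul_weylInvariantDim_per [NeZero m] (hm : 3 ≤ m) {d : ℕ}
    (lam : Nat.Partition (m * d)) (hlam : lam.parts.card ≤ m * m) :
    ((2 * (m * d).factorial * weylInvariantDim ℂ (m * m) lam
        ((linStabilizer (paddedPerFormLex ℂ m m)).comap (reindexGL (k := ℂ) (matIdxEquiv m))) : ℕ) : ℂ) =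
      ∑ τ : Equiv.Perm (Fin (m * d)), spechtCharacter ℂ lam τ *
        (((wordPermRep ℂ m (m * d)).subrepresentation (perSliceSpace ℂ m (m * d))
            (perSliceSpace_le_comap ℂ)).character τ ^ 2 +
          ((wordPermRep ℂ m (m * d)).subrepresentation (perSliceSpace ℂ m (m * d))
            (perSliceSpace_le_comap ℂ)).character (τ * τ)) := by
  rw [← perOrbitCeiling_eq_weylInvariantDim m hm lam hlam]
  exact two_mul_factorial_mul_perOrbitCeiling ℂ m lam hlam

end FullStabilizer

end Literature.Computability.AlgebraicComplexity
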